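import Mathlib
import Summits.ResolutionOfSingularities.ResolutionOfSingularities.Theorems.RadicialJungCleanModelsCleanProp44PointStepNoBad
import Summits.ResolutionOfSingularities.ResolutionOfSingularities.Theorems.RadicialJungCleanModelsPointChainCleanPermSeq
import Literature.AlgebraicGeometry.Resolution.BlowupDimension
import HarnessLib

/-!
# Route `RadicialJung`, crux `CleanModels` (stmt-ResolutionOfSingularities-15917), line `Sketch` rev 35, stub 6 `stub_cleanProp44` (X44c):
# an L7b INSERTION CHAIN keeps «no bad point»

Seat decomp-res-hand-2 g17, sequel of ✓ `…CleanProp44PointStepNoBad.lean` (`pointStep_noBad`).  The L7b insertions of the clean programme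
(✓ `exists_isCleanPermissibleSeq_blowup_curve_of_base`, hand-2 g10) are CHAINS of point blowing-ups following a regular curve `C₀` of the `μ`-stratum
(`IsPointChainAlong σ C₀ C x n`, ✓ `IsPointChainAlong.isCleanPermissibleSeq`: a legal clean-permissible extension, transform `J′` of order `≤ μ`, the
strict transform `C` again inside `{ord J′ = μ}`).  Here the same induction carries THREE more invariants: `V(J′)` of codimension `≥ 2`
(✓ `IsBlowup.one_lt_coheight_of_mem_support_controlledTransform`), dimension `≤ 3` (✓ `IsBlowup.topologicalKrullDim_le`) and — the point — NO BAD POINT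
(`pointStep_noBad` at each inserted point, which is a closed threefold point of the stratum lying on the followed curve).

* `IsPointChainAlong.isCleanPermissibleSeq_noBad` — ✓ `IsPointChainAlong.isCleanPermissibleSeq` with the riders `codim ≥ 2`, `dim ≤ 3`, «no bad point».

So a prover of the Phase II residual (R1ᵐⁱⁿ) (✓ `cleanProp44_of_phaseTwoMin_of_curveMinNoGamma`) may insert along an intersecting curve without leaving the
no-bad world; what the insertions do to the printed potential `Λ` (the near lines they bear, [CoP1] Lemma 4.3 (5)) is the research question.

Honest framing: OURS (bookkeeping); nothing here proves X44c, any case of `CleanModels`, or resolution of singularities in characteristic `p`.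
[cite: CossartPiltant2008, Lemma 4.3 (1) (3) (5); Prop. 4.2 (a); Prop. 4.4 (proof, p. 10)] [cite: Piltant2013, §2 Axiom 2 (ii)]
-/

noncomputable section

set_option linter.dupNamespace false -- mandated namespace of this single-conjunct summit

open CategoryTheory AlgebraicGeometry TopologicalSpace IsLocalRing Opposite
open Literature.AlgebraicGeometry.Resolution Literature.AlgebraicGeometry.Motives
open Scheme.IdealSheafData
open Summit.ResolutionOfSingularities.ResolutionOfSingularities.Theorems.CP2008Prop44

namespace Summit.ResolutionOfSingularities.ResolutionOfSingularities.Theorems.RadicialJung.CleanModels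

set_option maxHeartbeats 1600000 in
-- the chain induction with seven invariants
/-- **A chain of point blow-ups following a curve of the `μ`-stratum extends a clean-permissible sequence for `(J, μ)` AND KEEPS «no bad point».**
✓ `IsPointChainAlong.isCleanPermissibleSeq` verbatim, plus: if `V(J₁)` has codimension `≥ 2`, `dim X₁ ≤ 3` and `X₁` has no bad point for `(J₁, μ)`,
then the same three hold at the end of the chain for the transform `J′`. [cite: CossartPiltant2008, Lemma 4.3 (1) (3) (5); Prop. 4.2 (a)]
[cite: Piltant2013, §2 Axiom 2 (ii)] -/
theorem IsPointChainAlong.isCleanPermissibleSeq_noBad {p : ℕ} (hp : p.Prime) {X X₁ : Scheme.{0}} [IsIntegral X] [IsIntegral X₁]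
    [IsNoetherian X₁] {π : X₁ ⟶ X} [IsDominant π] {J : X.IdealSheafData} {μ : ℕ} {J₁ : X₁.IdealSheafData} {G : X.functionField}
    [CharP X.functionField p] (hπ : IsCleanPermissibleSeq p π J μ J₁ G)
    (hG : ∀ x : X, CleanRegAt p (algebraMap (X.presheaf.stalk x) X.functionField) G)
    (hX₁ : Scheme.IsRegular X₁) (hE₁ : Scheme.IsQuasiExcellent X₁) (hX3₁ : topologicalKrullDim X₁ ≤ 3) (hμ : 1 ≤ μ)
    (hJ₁le : ∀ x : X₁, idealOrder J₁ x ≤ μ) (hcodim₁ : ∀ z ∈ J₁.support, 1 < Order.coheight z)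
    (hRT₁ : ∀ y : X₁, ¬ ∃ C ∈ {C : Closeds X₁ | ∃ ζ ∈ maxPoints {z : X₁ | (μ : ℕ∞) ≤ idealOrder J₁ z},
        ¬ IsClosed ({ζ} : Set X₁) ∧ C = ⟨closure {ζ}, isClosed_closure⟩},
      y ∈ (vanishingIdeal C).subschemeι '' (Scheme.regularLocus (vanishingIdeal C).subscheme)ᶜ ∨
      (y ∈ (C : Set X₁) ∧ ∃ C' ∈ {C : Closeds X₁ | ∃ ζ ∈ maxPoints {z : X₁ | (μ : ℕ∞) ≤ idealOrder J₁ z},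
          ¬ IsClosed ({ζ} : Set X₁) ∧ C = ⟨closure {ζ}, isClosed_closure⟩}, C' ≠ C ∧ y ∈ (C' : Set X₁) ∧
        stalkIdeal (vanishingIdeal C) y ⊔ stalkIdeal (vanishingIdeal C') y ≠ maximalIdeal (X₁.presheaf.stalk y)))
    {C₀ : Closeds X₁}
    (hC₀reg : ∀ y ∈ (C₀ : Set X₁), ∃ c : Fin 2 → X₁.presheaf.stalk y, IsRsopPart c ∧ Ideal.span (Set.range c) = stalkIdeal (vanishingIdeal C₀) y)
    (hC₀μ : ∀ y ∈ (C₀ : Set X₁), idealOrder J₁ y = μ)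
    {X' : Scheme.{0}} [IsLocallyNoetherian X'] {σ : X' ⟶ X₁} {C : Closeds X'} {x : X'} {n : ℕ} (h : IsPointChainAlong σ C₀ C x n)
    (hxC₀ : σ x ∈ (C₀ : Set X₁)) (hdim₀ : ringKrullDim (X₁.presheaf.stalk (σ x)) = 3) (hx₀cl : IsClosed ({σ x} : Set X₁))
    (h0 : σ x ∈ closure ((C₀ : Set X₁) \ {σ x})) :
    ∃ (_ : IsIntegral X') (_ : IsDominant σ) (J' : X'.IdealSheafData), IsCleanPermissibleSeq p (σ ≫ π) J μ J' G ∧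
      (∀ x' : X', idealOrder J' x' ≤ μ) ∧ (∀ y ∈ (C : Set X'), idealOrder J' y = μ) ∧
      (∀ y : X', σ y ≠ σ x → idealOrder J' y = idealOrder J₁ (σ y)) ∧
      (∀ z ∈ J'.support, 1 < Order.coheight z) ∧ topologicalKrullDim X' ≤ 3 ∧
      (∀ y : X', ¬ ∃ C' ∈ {C' : Closeds X' | ∃ ζ ∈ maxPoints {z : X' | (μ : ℕ∞) ≤ idealOrder J' z},
          ¬ IsClosed ({ζ} : Set X') ∧ C' = ⟨closure {ζ}, isClosed_closure⟩},
        y ∈ (vanishingIdeal C').subschemeι '' (Scheme.regularLocus (vanishingIdeal C').subscheme)ᶜ ∨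
        (y ∈ (C' : Set X') ∧ ∃ C'' ∈ {C' : Closeds X' | ∃ ζ ∈ maxPoints {z : X' | (μ : ℕ∞) ≤ idealOrder J' z},
            ¬ IsClosed ({ζ} : Set X') ∧ C' = ⟨closure {ζ}, isClosed_closure⟩}, C'' ≠ C' ∧ y ∈ (C'' : Set X') ∧
          stalkIdeal (vanishingIdeal C') y ⊔ stalkIdeal (vanishingIdeal C'') y ≠ maximalIdeal (X'.presheaf.stalk y))) := by
  induction h with
  | nil C₀ x₀ =>
    exact ⟨inferInstance, inferInstance, J₁, by simpa using hπ, hJ₁le, hC₀μ, fun y _ => by simp, hcodim₁, hX3₁, hRT₁⟩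
  | @cons Xm Xt _ _ σ C₀ C n τ x' hx hchain hYreg hτ hx' ih =>
    have hστ : (τ ≫ σ) x' = σ (τ x') := by rw [Scheme.Hom.comp_apply]
    rw [hστ] at hxC₀ hdim₀ hx₀cl h0
    obtain ⟨hXint, hσdom, J', hseq, hle, hCμ, hoff, hcodim', hX3', hRT'⟩ := ih hC₀reg hC₀μ hxC₀ hdim₀ hx₀cl h0
    haveI := hXint
    haveI := hσdom
    obtain ⟨hXreg, hCreg, hxC, hdimx⟩ := data_along_pointChain hchain hX₁ hC₀reg hxC₀ hdim₀
    have hXE : Scheme.IsQuasiExcellent _ := hchain.isQuasiExcellent hE₁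
    -- the centre ideal is nonzero
    have hYbot : vanishingIdeal (⟨{τ x'}, hx⟩ : Closeds _) ≠ ⊥ := by
      intro hbot
      obtain ⟨c, hc, hspan⟩ := hCreg (τ x') hxC
      haveI := hc.1
      have hPle : stalkIdeal (vanishingIdeal C) (τ x') ≤ maximalIdeal _ :=
        (mem_support_iff_stalkIdeal_le _ _).mp
          (by rw [← SetLike.mem_coe, Scheme.IdealSheafData.coe_support_vanishingIdeal]; exact hxC)
      have hc0 : c 0 ∈ stalkIdeal (vanishingIdeal (⟨{τ x'}, hx⟩ : Closeds _)) (τ x') := by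
        rw [stalkIdeal_vanishingIdeal_singleton hx]
        exact hPle (hspan ▸ Ideal.subset_span ⟨0, rfl⟩)
      rw [hbot, stalkIdeal_bot, Ideal.mem_bot] at hc0
      exact hc.ne_zero 0 hc0
    haveI : IsIntegral _ := hτ.isIntegral hYbot
    haveI : IsDominant τ := isDominant_of_isBlowup_of_ne_bot hτ hYbot
    -- the new stage is Noetherian (for upper semicontinuity of the order)
    haveI : IsProper σ := hchain.isProper
    haveI : IsProper τ := hτ.isProper
    haveI : CompactSpace Xt := QuasiCompact.compactSpace_of_compactSpace (τ ≫ σ)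
    haveI : IsNoetherian Xt := {}
    -- the step
    have hint := isIntegral_subscheme_vanishingIdeal_singleton hx
    have hord : idealOrder J' (τ x') = μ := hCμ _ hxC
    have key := IsCleanPermissibleSeq.cons_point hp τ (σ ≫ π) J μ J' G hseq (τ x') hx hint hYreg hord hτ
      (hseq.cleanRegAt hp inferInstance hG (τ x'))
    set J'' := controlledTransform τ (vanishingIdeal (⟨{τ x'}, hx⟩ : Closeds _)) J' μ with hJ''
    -- orders of `J''`
    have hY : ∀ y ∈ ((⟨{τ x'}, hx⟩ : Closeds _) : Set _), idealOrder J' y = μ := by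
      intro y hy
      have hy' : y = τ x' := hy
      subst hy'
      exact hord
    have hle'' : ∀ z, idealOrder J'' z ≤ μ := fun z => hτ.idealOrder_controlledTransform_le_of_forall hXreg hYreg hY hle z
    have hoff'' : ∀ z, τ z ≠ τ x' → idealOrder J'' z = idealOrder J' (τ z) := by
      intro z hz
      refine hτ.idealOrder_controlledTransform_of_not_mem J' μ ?_
      rw [Scheme.IdealSheafData.coe_support_vanishingIdeal]
      exact hz
    have hne'' : J'' ≠ ⊥ := by
      intro hbot
      have h1 : ((μ + 1 : ℕ) : ℕ∞) ≤ idealOrder J'' x' := by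
        rw [le_idealOrder_iff, hbot, stalkIdeal_bot]; exact bot_le
      have h2 : ((μ + 1 : ℕ) : ℕ∞) ≤ (μ : ℕ∞) := h1.trans (hle'' x')
      exact (not_le.mpr (by exact_mod_cast Nat.lt_succ_self μ)) h2
    have hX' : Scheme.IsRegular _ := (strictTransform_curve_data_of_isBlowup_point hXreg hx hYreg hτ hCreg hxC hdimx hx').1
    have hclosed : IsClosed {z | (μ : ℕ∞) ≤ idealOrder J'' z} :=
      isClosed_setOf_le_idealOrder_of_isJ2 hX' (fun U => (hτ.isQuasiExcellent hXE U).2) hne'' μ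
    have hCμ'' : ∀ y ∈ closure (τ ⁻¹' ((C : Set _) \ {τ x'})), idealOrder J'' y = μ := by
      have hsub : τ ⁻¹' ((C : Set _) \ {τ x'}) ⊆ {z | (μ : ℕ∞) ≤ idealOrder J'' z} := by
        rintro z ⟨hzC, hzx⟩
        change (μ : ℕ∞) ≤ idealOrder J'' z
        rw [hoff'' z hzx, hCμ _ hzC]
      intro y hy
      exact le_antisymm (hle'' y) ((hclosed.closure_subset_iff.mpr hsub) hy)
    -- the three riders
    have hcodim'' : ∀ z ∈ J''.support, 1 < Order.coheight z := fun z hz =>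
      hτ.one_lt_coheight_of_mem_support_controlledTransform hXreg hYreg hY hcodim' hz
    have hX3'' : topologicalKrullDim Xt ≤ 3 := hτ.topologicalKrullDim_le hX3'
    have hdimspan : (maximalIdeal (Xm.presheaf.stalk (τ x'))).spanFinrank = 3 := by
      haveI : IsRegularLocalRing (Xm.presheaf.stalk (τ x')) := hXreg (τ x')
      have h1 := IsRegularLocalRing.spanFinrank_maximalIdeal (R := Xm.presheaf.stalk (τ x'))
      rw [hdimx] at h1
      exact_mod_cast h1
    have hRT'' := pointStep_noBad hXreg hX3' J' hμ hle hcodim' (𝒞 := {C' : Closeds Xm | _}) (fun _ => Iff.rfl) hRT' hx hord hdimspan hτ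
      (𝒞' := {C' : Closeds Xt | _}) (fun _ => Iff.rfl)
    refine ⟨inferInstance, inferInstance, J'', by simpa only [Category.assoc] using key, hle'', hCμ'', fun y hy => ?_, hcodim'', hX3'', hRT''⟩
    have hy' : σ (τ y) ≠ σ (τ x') := by
      intro heq; apply hy; rw [Scheme.Hom.comp_apply, Scheme.Hom.comp_apply, heq]
    have hne : τ y ≠ τ x' := fun heq => hy' (by rw [heq])
    rw [Scheme.Hom.comp_apply, hoff'' y hne, hoff _ hy']

end Summit.ResolutionOfSingularities.ResolutionOfSingularities.Theorems.RadicialJung.CleanModels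

end
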